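import Literature.Topology.FourManifolds.HomotopySpheres
import Literature.Geometry.Symplectic.StandardEnd
import Literature.Geometry.Kaehler.ManifoldFormsChart
import Literature.Geometry.Kaehler.ManifoldFormsPullback
import Literature.Geometry.Kaehler.PullbackFamilyChart
import Literature.Analysis.FunctionSpaces.ParametricIntegralSmooth
import Mathlib.MeasureTheory.Integral.Bochner.ContinuousLinearMap
import Mathlib.MeasureTheory.Integral.Bochner.Set
import Mathlib.Analysis.SpecialFunctions.SmoothTransition
import Mathlib.Analysis.Calculus.BumpFunction.FiniteDimension

/-!
# Helper `helper_integralForm` of stub `stub_croftonTaming` — line `crofton-pencil-laminar-charge`,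
crux `SullivanDual.Target` (stmt-SmoothPoincare4-7823), skeleton v2
(`Cruxes/Target/Lines/crofton_pencil_laminar_charge.lean`)

**Parametric integrals of families of differential forms.** Let `M` be a manifold modelled on
`EuclideanSpace ℝ (Fin n)` (boundaryless model `𝓡 n`) and `γ : ℂ → MForm (𝓡 n) M F k` a family
of `k`-forms such that

* `γ a = 0` for `R ≤ ‖a‖` (compact support in the parameter);
* for every `x₀ : M`, the chart representatives `(a, y) ↦ (γ a).inChart x₀ y` are jointly `C^∞`
  at every `(a, y)` with `y` in the target of the chart at `x₀`;
* every `γ a` is closed.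

Then the form `sfI x = ∫ a, γ a x` (Bochner integral over `ℂ`, pointwise in `x`) is smooth
(`IsSmoothForm`), closed (`IsClosedForm`), and its evaluation commutes with the integral. The
registered statement `helper_integralForm` is the instance `M = Σ ∖ {p}` (`punctured p`) for a
homotopy `4`-sphere `Σ`, `k = 2`, `F = ℝ`.

Proof. (1) `a ↦ γ a z` is continuous (restrict the joint smoothness to the centre of the chart
at `z`, `MForm.inChart_apply_self`) and compactly supported, hence integrable, so
`sfI.inChart x₀ y = ∫ a, (γ a).inChart x₀ y` (`compContinuousLinearMapCLM` commutes with `∫`).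
(2) With a bump `χ = 1` near the chart point and `tsupport χ ⊆` chart target, the cut-off
integrand `(a, y) ↦ χ y • (γ a).inChart x₀ y` is globally `C^∞`, and its integral over the ball
`‖a‖ ≤ R` is a `C^∞` function of `y`
(`Literature.Analysis.FunctionSpaces.contDiff_parametric_integral`) agreeing with
`sfI.inChart x₀` near the chart point: smoothness. (3) `d` of the parametric integral is computed
under the integral sign (`hasFDerivAt_parametric_integral`); pointwise in `a` the integrand is
`extDeriv ((γ a).inChart x₀) = mextDeriv (γ a) x₀ = 0`: closedness. (4) Evaluation at a tuple is
a continuous linear map, which commutes with `∫`.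
-/

noncomputable section

-- the prescribed namespace `Summit.<P>.<Sub>.…` duplicates `SmoothPoincare4` (P = Sub)
set_option linter.dupNamespace false

-- `TangentSpace (𝓡 n) x` is definitionally the model space; let unification see through it
set_option backward.isDefEq.respectTransparency false

open scoped Manifold ContDiff Topology
open Set Filter MeasureTheory Literature.Geometry.Kaehler Literature.Geometry.Symplectic
  Literature.Topology.FourManifolds

namespace Summit.SmoothPoincare4.SmoothPoincare4.Theorems.Target.CroftonPencil

section General

variable {n k : ℕ} {M : Type*} [TopologicalSpace M] [ChartedSpace (EuclideanSpace ℝ (Fin n)) M]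
  {F : Type*} [NormedAddCommGroup F] [NormedSpace ℝ F]

/-- A continuous linear map kills an integral as soon as it kills the integrand pointwise (no
integrability needed: a non-integrable function has integral `0`). [folklore] -/
theorem clm_integral_eq_zero {X : Type*} [MeasurableSpace X] {μ : Measure X} {G H : Type*}
    [NormedAddCommGroup G] [NormedSpace ℝ G] [CompleteSpace G] [NormedAddCommGroup H]
    [NormedSpace ℝ H] [CompleteSpace H] (L : G →L[ℝ] H) {φ : X → G} (h : ∀ x, L (φ x) = 0) :
    L (∫ x, φ x ∂μ) = 0 := by
  by_cases hφ : Integrable φ μ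
  · rw [← L.integral_comp_comm hφ]
    simp only [h, integral_zero]
  · rw [integral_undef hφ, map_zero]

/-- Pull-back along a linear map commutes with the Bochner integral of alternating maps.
[folklore] -/
theorem integral_compContinuousLinearMap [CompleteSpace F] {X : Type*} [MeasurableSpace X]
    {μ : Measure X} {E E' : Type*} [NormedAddCommGroup E] [NormedSpace ℝ E]
    [NormedAddCommGroup E'] [NormedSpace ℝ E'] (D : E' →L[ℝ] E) {φ : X → E [⋀^Fin k]→L[ℝ] F}
    (hφ : Integrable φ μ) :
    (∫ x, φ x ∂μ).compContinuousLinearMap D = ∫ x, (φ x).compContinuousLinearMap D ∂μ := by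
  have h := (ContinuousLinearMap.integral_comp_comm
    (ContinuousAlternatingMap.compContinuousLinearMapCLM D) hφ).symm
  simpa only [ContinuousAlternatingMap.compContinuousLinearMapCLM_apply] using h

/-- A bump function around the chart point, equal to `1` near it, with support inside the chart
target. [folklore] -/
theorem exists_bump_chart' (x₀ : M) :
    ∃ χ : EuclideanSpace ℝ (Fin n) → ℝ, ContDiff ℝ ∞ χ ∧
      tsupport χ ⊆ (extChartAt (𝓡 n) x₀).target ∧ χ =ᶠ[𝓝 (extChartAt (𝓡 n) x₀ x₀)] 1 := by
  -- adapted from `Literature.Geometry.Manifold.exists_bump_chart` (CircleActionOrbitAverage)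
  obtain ⟨ε, hε, hball⟩ := Metric.isOpen_iff.1 (isOpen_extChartAt_target (I := 𝓡 n) x₀) _
    (mem_extChartAt_target (I := 𝓡 n) x₀)
  let f : ContDiffBump (extChartAt (𝓡 n) x₀ x₀) :=
    { rIn := ε / 4
      rOut := ε / 2
      rIn_pos := by positivity
      rIn_lt_rOut := by linarith }
  refine ⟨f, f.contDiff, ?_, f.eventuallyEq_one⟩
  rw [f.tsupport_eq]
  exact (Metric.closedBall_subset_ball (by show ε / 2 < ε; linarith)).trans hball

variable {γ : ℂ → MForm (𝓡 n) M F k} {R : ℝ}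

/-- The cut-off chart integrand `(a, y) ↦ χ y • (γ a).inChart x₀ y` is globally `C^∞` when
`tsupport χ` lies in the chart target. [folklore] -/
theorem contDiff_cutoff_integrand
    (hs : ∀ (x₀ : M) (q : ℂ × EuclideanSpace ℝ (Fin n)), q.2 ∈ (extChartAt (𝓡 n) x₀).target →
      ContDiffAt ℝ ∞ (fun q' : ℂ × EuclideanSpace ℝ (Fin n) => (γ q'.1).inChart x₀ q'.2) q)
    (x₀ : M) {χ : EuclideanSpace ℝ (Fin n) → ℝ} (hχ : ContDiff ℝ ∞ χ)
    (hχt : tsupport χ ⊆ (extChartAt (𝓡 n) x₀).target) :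
    ContDiff ℝ ∞ fun q : ℂ × EuclideanSpace ℝ (Fin n) => χ q.2 • (γ q.1).inChart x₀ q.2 := by
  rw [contDiff_iff_contDiffAt]
  rintro ⟨a, y⟩
  by_cases hy : y ∈ (extChartAt (𝓡 n) x₀).target
  · exact (hχ.contDiffAt.comp (a, y) contDiffAt_snd).smul (hs x₀ (a, y) hy)
  · have hy' : y ∉ tsupport χ := fun h => hy (hχt h)
    have hzero : χ =ᶠ[𝓝 y] 0 := notMem_tsupport_iff_eventuallyEq.1 hy'
    have hev : (fun q : ℂ × EuclideanSpace ℝ (Fin n) => χ q.2 • (γ q.1).inChart x₀ q.2)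
        =ᶠ[𝓝 (a, y)] fun _ => 0 := by
      have h := (continuousAt_snd (p := (a, y))).eventually hzero
      filter_upwards [h] with q hq
      simp only [Pi.zero_apply] at hq
      simp [hq]
    exact (contDiffAt_const
      (c := (0 : EuclideanSpace ℝ (Fin n) [⋀^Fin k]→L[ℝ] F))).congr_of_eventuallyEq hev

/-- The integral over `ℂ` of the cut-off integrand is its integral over the ball `‖a‖ ≤ R`.
[folklore] -/
theorem integral_cutoff_eq_setIntegral (hR : ∀ a : ℂ, R ≤ ‖a‖ → γ a = 0) (x₀ : M)
    (χ : EuclideanSpace ℝ (Fin n) → ℝ) (y : EuclideanSpace ℝ (Fin n)) :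
    ∫ a, χ y • (γ a).inChart x₀ y =
      ∫ a, (fun q : ℂ × EuclideanSpace ℝ (Fin n) => χ q.2 • (γ q.1).inChart x₀ q.2) (id a, y)
        ∂((volume : Measure ℂ).restrict (Metric.closedBall (0 : ℂ) R)) := by
  refine (setIntegral_eq_integral_of_forall_compl_eq_zero fun a ha => ?_).symm
  rw [Metric.mem_closedBall, dist_zero_right, not_le] at ha
  simp [hR a ha.le]

/-- **The cut-off parametric integral is smooth** in the chart variable. [folklore] -/
theorem contDiff_integral_cutoff [CompleteSpace F] (hR : ∀ a : ℂ, R ≤ ‖a‖ → γ a = 0)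
    (hs : ∀ (x₀ : M) (q : ℂ × EuclideanSpace ℝ (Fin n)), q.2 ∈ (extChartAt (𝓡 n) x₀).target →
      ContDiffAt ℝ ∞ (fun q' : ℂ × EuclideanSpace ℝ (Fin n) => (γ q'.1).inChart x₀ q'.2) q)
    (x₀ : M) {χ : EuclideanSpace ℝ (Fin n) → ℝ} (hχ : ContDiff ℝ ∞ χ)
    (hχt : tsupport χ ⊆ (extChartAt (𝓡 n) x₀).target) :
    ContDiff ℝ ∞ fun y : EuclideanSpace ℝ (Fin n) => ∫ a, χ y • (γ a).inChart x₀ y := by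
  have heq : (fun y : EuclideanSpace ℝ (Fin n) => ∫ a, χ y • (γ a).inChart x₀ y) =
      fun y => ∫ a, (fun q : ℂ × EuclideanSpace ℝ (Fin n) => χ q.2 • (γ q.1).inChart x₀ q.2)
        (id a, y) ∂((volume : Measure ℂ).restrict (Metric.closedBall (0 : ℂ) R)) :=
    funext fun y => integral_cutoff_eq_setIntegral hR x₀ χ y
  rw [heq]
  haveI : IsFiniteMeasure ((volume : Measure ℂ).restrict (Metric.closedBall (0 : ℂ) R)) :=
    ⟨by rw [Measure.restrict_apply_univ]; exact measure_closedBall_lt_top⟩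
  exact Literature.Analysis.FunctionSpaces.contDiff_parametric_integral
    (μ := (volume : Measure ℂ).restrict (Metric.closedBall (0 : ℂ) R)) (ι := (id : ℂ → ℂ))
    measurable_id (isCompact_closedBall (0 : ℂ) R) (ae_restrict_mem measurableSet_closedBall)
    (contDiff_cutoff_integrand hs x₀ hχ hχt)

variable [IsManifold (𝓡 n) ∞ M]

/-- For a family whose chart representatives are jointly smooth, `a ↦ γ a z` is continuous
(restrict to the centre of the chart at `z`). [folklore] -/
theorem continuous_family_apply
    (hs : ∀ (x₀ : M) (q : ℂ × EuclideanSpace ℝ (Fin n)), q.2 ∈ (extChartAt (𝓡 n) x₀).target →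
      ContDiffAt ℝ ∞ (fun q' : ℂ × EuclideanSpace ℝ (Fin n) => (γ q'.1).inChart x₀ q'.2) q)
    (z : M) :
    Continuous (Y := EuclideanSpace ℝ (Fin n) [⋀^Fin k]→L[ℝ] F) fun a : ℂ => γ a z := by
  have heq : (fun a : ℂ => (γ a).inChart z (extChartAt (𝓡 n) z z)) =
      (fun a : ℂ => γ a z : ℂ → EuclideanSpace ℝ (Fin n) [⋀^Fin k]→L[ℝ] F) := by
    funext a
    exact MForm.inChart_apply_self (γ a) z
  rw [← heq, continuous_iff_continuousAt]
  intro a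
  have h := (hs z (a, extChartAt (𝓡 n) z z) (mem_extChartAt_target (I := 𝓡 n) z)).continuousAt
  exact ContinuousAt.comp (f := fun b : ℂ => (b, extChartAt (𝓡 n) z z)) h
    (Continuous.prodMk_left _).continuousAt

/-- `a ↦ γ a z` is integrable over `ℂ` (continuous with support in the ball `‖a‖ ≤ R`).
[folklore] -/
theorem integrable_family_apply [CompleteSpace F] (hR : ∀ a : ℂ, R ≤ ‖a‖ → γ a = 0)
    (hs : ∀ (x₀ : M) (q : ℂ × EuclideanSpace ℝ (Fin n)), q.2 ∈ (extChartAt (𝓡 n) x₀).target →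
      ContDiffAt ℝ ∞ (fun q' : ℂ × EuclideanSpace ℝ (Fin n) => (γ q'.1).inChart x₀ q'.2) q)
    (z : M) :
    Integrable (ε := EuclideanSpace ℝ (Fin n) [⋀^Fin k]→L[ℝ] F) fun a : ℂ => γ a z := by
  refine (continuous_family_apply hs z).integrable_of_hasCompactSupport ?_
  refine HasCompactSupport.intro (isCompact_closedBall (0 : ℂ) R) fun a ha => ?_
  rw [Metric.mem_closedBall, dist_zero_right, not_le] at ha
  have h := congrFun (hR a ha.le) z
  simpa using h

/-- **Chart representative of the integrated form**: `sfI.inChart x₀ y = ∫ a, (γ a).inChart x₀ y`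
at every `y`. [folklore] -/
theorem inChart_integralForm [CompleteSpace F] (hR : ∀ a : ℂ, R ≤ ‖a‖ → γ a = 0)
    (hs : ∀ (x₀ : M) (q : ℂ × EuclideanSpace ℝ (Fin n)), q.2 ∈ (extChartAt (𝓡 n) x₀).target →
      ContDiffAt ℝ ∞ (fun q' : ℂ × EuclideanSpace ℝ (Fin n) => (γ q'.1).inChart x₀ q'.2) q)
    {sfI : MForm (𝓡 n) M F k}
    (hsf : ∀ x : M, sfI x = ((∫ a, (γ a x : EuclideanSpace ℝ (Fin n) [⋀^Fin k]→L[ℝ] F)) :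
      EuclideanSpace ℝ (Fin n) [⋀^Fin k]→L[ℝ] F))
    (x₀ : M) (y : EuclideanSpace ℝ (Fin n)) :
    sfI.inChart x₀ y = ∫ a, (γ a).inChart x₀ y := by
  simp only [MForm.inChart]
  rw [hsf]
  exact integral_compContinuousLinearMap (E := EuclideanSpace ℝ (Fin n))
    (E' := EuclideanSpace ℝ (Fin n)) _ (integrable_family_apply hR hs _)

/-- Near the chart point the chart representative of `sfI` is the cut-off parametric integral.
[folklore] -/
theorem inChart_eventuallyEq_integral_cutoff [CompleteSpace F] (hR : ∀ a : ℂ, R ≤ ‖a‖ → γ a = 0)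
    (hs : ∀ (x₀ : M) (q : ℂ × EuclideanSpace ℝ (Fin n)), q.2 ∈ (extChartAt (𝓡 n) x₀).target →
      ContDiffAt ℝ ∞ (fun q' : ℂ × EuclideanSpace ℝ (Fin n) => (γ q'.1).inChart x₀ q'.2) q)
    {sfI : MForm (𝓡 n) M F k}
    (hsf : ∀ x : M, sfI x = ((∫ a, (γ a x : EuclideanSpace ℝ (Fin n) [⋀^Fin k]→L[ℝ] F)) :
      EuclideanSpace ℝ (Fin n) [⋀^Fin k]→L[ℝ] F))
    (x₀ : M) {χ : EuclideanSpace ℝ (Fin n) → ℝ} (hχ1 : χ =ᶠ[𝓝 (extChartAt (𝓡 n) x₀ x₀)] 1) :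
    sfI.inChart x₀ =ᶠ[𝓝 (extChartAt (𝓡 n) x₀ x₀)]
      fun y : EuclideanSpace ℝ (Fin n) => ∫ a, χ y • (γ a).inChart x₀ y := by
  filter_upwards [hχ1] with y hy
  rw [inChart_integralForm hR hs hsf x₀ y]
  simp only [hy, Pi.one_apply, one_smul]

/-- **The integrated form is smooth.** [folklore] -/
theorem isSmoothForm_integralForm [CompleteSpace F] (hR : ∀ a : ℂ, R ≤ ‖a‖ → γ a = 0)
    (hs : ∀ (x₀ : M) (q : ℂ × EuclideanSpace ℝ (Fin n)), q.2 ∈ (extChartAt (𝓡 n) x₀).target →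
      ContDiffAt ℝ ∞ (fun q' : ℂ × EuclideanSpace ℝ (Fin n) => (γ q'.1).inChart x₀ q'.2) q)
    {sfI : MForm (𝓡 n) M F k}
    (hsf : ∀ x : M, sfI x = ((∫ a, (γ a x : EuclideanSpace ℝ (Fin n) [⋀^Fin k]→L[ℝ] F)) :
      EuclideanSpace ℝ (Fin n) [⋀^Fin k]→L[ℝ] F)) :
    IsSmoothForm sfI := by
  intro x₀
  obtain ⟨χ, hχ, hχt, hχ1⟩ := exists_bump_chart' (n := n) x₀
  have hF := (contDiff_integral_cutoff hR hs x₀ hχ hχt).contDiffAt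
    (x := extChartAt (𝓡 n) x₀ x₀)
  exact (hF.congr_of_eventuallyEq
    (inChart_eventuallyEq_integral_cutoff hR hs hsf x₀ hχ1)).contDiffWithinAt

/-- Pointwise in the parameter, `d` of the cut-off integrand at the chart point vanishes when
`γ a` is closed: it is `extDeriv ((γ a).inChart x₀) = mextDeriv (γ a) x₀ = 0`. [folklore] -/
theorem alternatize_fderiv_cutoff_eq_zero
    (hs : ∀ (x₀ : M) (q : ℂ × EuclideanSpace ℝ (Fin n)), q.2 ∈ (extChartAt (𝓡 n) x₀).target →
      ContDiffAt ℝ ∞ (fun q' : ℂ × EuclideanSpace ℝ (Fin n) => (γ q'.1).inChart x₀ q'.2) q)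
    (hc : ∀ a : ℂ, IsClosedForm (γ a)) (x₀ : M) {χ : EuclideanSpace ℝ (Fin n) → ℝ}
    (hχ : ContDiff ℝ ∞ χ) (hχt : tsupport χ ⊆ (extChartAt (𝓡 n) x₀).target)
    (hχ1 : χ =ᶠ[𝓝 (extChartAt (𝓡 n) x₀ x₀)] 1) (a : ℂ) :
    ContinuousAlternatingMap.alternatizeUncurryFin
      ((fderiv ℝ (fun q : ℂ × EuclideanSpace ℝ (Fin n) => χ q.2 • (γ q.1).inChart x₀ q.2)
        (a, extChartAt (𝓡 n) x₀ x₀)).comp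
        (ContinuousLinearMap.inr ℝ ℂ (EuclideanSpace ℝ (Fin n)))) = 0 := by
  have hG := contDiff_cutoff_integrand hs x₀ hχ hχt
  rw [← (Literature.Analysis.FunctionSpaces.hasFDerivAt_comp_prodMk_right hG (by simp) a
    (extChartAt (𝓡 n) x₀ x₀)).fderiv]
  have hev : (fun y : EuclideanSpace ℝ (Fin n) => χ y • (γ a).inChart x₀ y)
      =ᶠ[𝓝 (extChartAt (𝓡 n) x₀ x₀)] (γ a).inChart x₀ := by
    filter_upwards [hχ1] with y hy
    simp only [hy, Pi.one_apply, one_smul]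
  rw [hev.fderiv_eq]
  have h1 : ContinuousAlternatingMap.alternatizeUncurryFin
      (fderiv ℝ ((γ a).inChart x₀) (extChartAt (𝓡 n) x₀ x₀)) =
      extDerivWithin ((γ a).inChart x₀) (range (𝓡 n)) (extChartAt (𝓡 n) x₀ x₀) := by
    rw [ModelWithCorners.Boundaryless.range_eq_univ, extDerivWithin_univ]
    rfl
  have h2 : extDerivWithin ((γ a).inChart x₀) (range (𝓡 n)) (extChartAt (𝓡 n) x₀ x₀) = 0 := by
    rw [← mextDeriv_eq_extDerivWithin]
    exact congrFun (hc a) x₀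
  rw [h1, h2]

/-- **The integrated form is closed.** [folklore] -/
theorem isClosedForm_integralForm [CompleteSpace F] (hR : ∀ a : ℂ, R ≤ ‖a‖ → γ a = 0)
    (hs : ∀ (x₀ : M) (q : ℂ × EuclideanSpace ℝ (Fin n)), q.2 ∈ (extChartAt (𝓡 n) x₀).target →
      ContDiffAt ℝ ∞ (fun q' : ℂ × EuclideanSpace ℝ (Fin n) => (γ q'.1).inChart x₀ q'.2) q)
    (hc : ∀ a : ℂ, IsClosedForm (γ a)) {sfI : MForm (𝓡 n) M F k}
    (hsf : ∀ x : M, sfI x = ((∫ a, (γ a x : EuclideanSpace ℝ (Fin n) [⋀^Fin k]→L[ℝ] F)) :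
      EuclideanSpace ℝ (Fin n) [⋀^Fin k]→L[ℝ] F)) :
    IsClosedForm sfI := by
  funext x₀
  obtain ⟨χ, hχ, hχt, hχ1⟩ := exists_bump_chart' (n := n) x₀
  set K : Set ℂ := Metric.closedBall (0 : ℂ) R
  set G : ℂ × EuclideanSpace ℝ (Fin n) → EuclideanSpace ℝ (Fin n) [⋀^Fin k]→L[ℝ] F :=
    fun q => χ q.2 • (γ q.1).inChart x₀ q.2
  have hG : ContDiff ℝ ∞ G := contDiff_cutoff_integrand hs x₀ hχ hχt
  haveI : IsFiniteMeasure ((volume : Measure ℂ).restrict K) :=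
    ⟨by rw [Measure.restrict_apply_univ]; exact measure_closedBall_lt_top⟩
  -- the chart representative near the chart point is the parametric integral over the ball
  have hev : sfI.inChart x₀ =ᶠ[𝓝 (extChartAt (𝓡 n) x₀ x₀)]
      fun y => ∫ a, G (id a, y) ∂((volume : Measure ℂ).restrict K) := by
    filter_upwards [inChart_eventuallyEq_integral_cutoff hR hs hsf x₀ hχ1] with y hy
    rw [hy]
    exact integral_cutoff_eq_setIntegral hR x₀ χ y
  have hD := Literature.Analysis.FunctionSpaces.hasFDerivAt_parametric_integral
    (μ := (volume : Measure ℂ).restrict K) (ι := (id : ℂ → ℂ)) measurable_id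
    (isCompact_closedBall (0 : ℂ) R) (ae_restrict_mem measurableSet_closedBall) hG (by simp)
    (extChartAt (𝓡 n) x₀ x₀)
  rw [mextDeriv_eq_extDerivWithin, ModelWithCorners.Boundaryless.range_eq_univ,
    extDerivWithin_univ, hev.extDeriv_eq]
  show ContinuousAlternatingMap.alternatizeUncurryFin _ = 0
  rw [hD.fderiv, ← ContinuousAlternatingMap.alternatizeUncurryFinCLM_apply]
  refine clm_integral_eq_zero (X := ℂ) (μ := (volume : Measure ℂ).restrict K)
    (G := EuclideanSpace ℝ (Fin n) →L[ℝ] EuclideanSpace ℝ (Fin n) [⋀^Fin k]→L[ℝ] F)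
    (H := EuclideanSpace ℝ (Fin n) [⋀^Fin (k + 1)]→L[ℝ] F)
    (ContinuousAlternatingMap.alternatizeUncurryFinCLM ℝ (EuclideanSpace ℝ (Fin n)) F) fun a => ?_
  rw [ContinuousAlternatingMap.alternatizeUncurryFinCLM_apply]
  exact alternatize_fderiv_cutoff_eq_zero hs hc x₀ hχ hχt hχ1 (id a)

/-- **Evaluation commutes with the integral.** [folklore] -/
theorem integralForm_apply [CompleteSpace F] (hR : ∀ a : ℂ, R ≤ ‖a‖ → γ a = 0)
    (hs : ∀ (x₀ : M) (q : ℂ × EuclideanSpace ℝ (Fin n)), q.2 ∈ (extChartAt (𝓡 n) x₀).target →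
      ContDiffAt ℝ ∞ (fun q' : ℂ × EuclideanSpace ℝ (Fin n) => (γ q'.1).inChart x₀ q'.2) q)
    {sfI : MForm (𝓡 n) M F k}
    (hsf : ∀ x : M, sfI x = ((∫ a, (γ a x : EuclideanSpace ℝ (Fin n) [⋀^Fin k]→L[ℝ] F)) :
      EuclideanSpace ℝ (Fin n) [⋀^Fin k]→L[ℝ] F))
    (x : M) (m : Fin k → TangentSpace (𝓡 n) x) : sfI x m = ∫ a, γ a x m := by
  rw [hsf x]
  have h := (ContinuousLinearMap.integral_comp_comm (μ := (volume : Measure ℂ))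
    (ContinuousAlternatingMap.apply ℝ (EuclideanSpace ℝ (Fin n)) F
      (m : Fin k → EuclideanSpace ℝ (Fin n)))
    (integrable_family_apply hR hs x)).symm
  simp only [ContinuousAlternatingMap.apply_apply] at h
  exact h

end General

/-- **Registered helper `helper_integralForm`** (signature registered verbatim on
stmt-SmoothPoincare4-7823): on the punctured homotopy `4`-sphere `Σ ∖ {p}`, a family
`γ : ℂ → (2-forms)` vanishing for `‖a‖ ≥ R`, with jointly `C^∞` chart representatives and every
`γ a` closed, integrates (Bochner integral over `ℂ`, pointwise) to a smooth closed `2`-form whose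
evaluation commutes with the integral. Differentiation under the integral sign (Hörmander,
*ALPDO I*, Thm. 1.1.9) in charts. [folklore] -/
theorem helper_integralForm :
    ∀ (S : HomotopySphere 4) (p : S.carrier)
      (γ : ℂ → MForm (𝓡 4) (punctured p) ℝ 2) (R : ℝ),
      (∀ a : ℂ, R ≤ ‖a‖ → γ a = 0) →
      (∀ (x₀ : punctured p) (q : ℂ × EuclideanSpace ℝ (Fin 4)),
        q.2 ∈ (extChartAt (𝓡 4) x₀).target →
        ContDiffAt ℝ ∞ (fun q' : ℂ × EuclideanSpace ℝ (Fin 4) => (γ q'.1).inChart x₀ q'.2) q) →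
      (∀ a : ℂ, IsClosedForm (γ a)) →
      ∀ sfI : MForm (𝓡 4) (punctured p) ℝ 2,
        (∀ x : punctured p, sfI x =
          ((∫ a, (γ a x : EuclideanSpace ℝ (Fin 4) [⋀^Fin 2]→L[ℝ] ℝ)) :
            EuclideanSpace ℝ (Fin 4) [⋀^Fin 2]→L[ℝ] ℝ)) →
        IsSmoothForm sfI ∧ IsClosedForm sfI ∧
        ∀ (x : punctured p) (m : Fin 2 → TangentSpace (𝓡 4) x), sfI x m = ∫ a, γ a x m := by
  intro S p γ R hR hs hc sfI hsf
  exact ⟨isSmoothForm_integralForm hR hs hsf, isClosedForm_integralForm hR hs hc hsf,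
    fun x m => integralForm_apply hR hs hsf x m⟩

end Summit.SmoothPoincare4.SmoothPoincare4.Theorems.Target.CroftonPencil

end
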